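import Mathlib
import Summits.Ventures.PercRepro.TriangleCapFourRowTwo
import Summits.Ventures.PercRepro.TriangleCapTFamilyGen

/-!
# PercRepro — THE NON-BIPARTITE SECOND-BEST VALUE ON THE CELL `(k, 4, 2)`: over the `K₄⁻`-free graphs on `Fin k`
with `4 (k − 4) − 2` edges that are NOT `4`-bipartite, the maximum of `Σ_v d(v)²` is EXACTLY
`m k − 2 (k − 3) − 2 (k − 9)` for every `k ≥ 10` — the one-triangle family `T = 2k − 18` (p3, gen 45; part 198d)

The bound is part 198b (`four_two_second_order`), the witness part 198c (`tFamilyGen n 4 0` on `Fin (n + 1)`: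
`K_{4,k−5}` with a vertex hung on an edge). In the table's coordinates (`cherries`): the maximum of
`2 · Σ_v C(d(v), 2)` over the non-`4`-bipartite graphs of the cell is `m (k − 2) − 2 (k − 3) − 2 (k − 9)`
(`four_two_nonbip_second_best_cherries`). With parts 196c/197i this completes the stability table §10bt(e) on every
cell with `r ≤ 2`: the non-`a`-bipartite gap is `B2 = 2 (k − 2a − 1)(a − r)` on every cell with `r ≤ a − 3` and
`T = 2k − 18` on `(k, 4, 2)` (`r = a − 2`; the row `a = 3` is part 190's `T = 2 (k − 7)` at `r = 1`). Axioms: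
standard.
-/

namespace PercRepro

namespace TriangleCap

namespace C047

open Finset

/-- **THE NON-`4`-BIPARTITE SECOND-BEST VALUE ON THE CELL `(k, 4, 2)`, `10 ≤ k`:** every `K₄⁻`-free graph on
`Fin k` with `4 (k − 4) − 2` edges that is not a spanning subgraph of any `K(A, Aᶜ)` with `|A| = 4` has
`Σ_v d(v)² + 2 (k − 3) + 2 (k − 9) ≤ m k`, and the value is attained by `K_{4,k−5}` with a vertex hung on an
edge. -/
theorem four_two_nonbip_second_best (k : ℕ) (hk : 10 ≤ k) :
    (∀ (D : SimpleGraph (Fin k)) [DecidableRel D.Adj], K4mFree D → D.edgeFinset.card + 2 = 4 * (k - 4) →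
        (¬ ∃ A : Finset (Fin k), A.card = 4 ∧ BipSub D A) →
        ∑ v, deg D v * deg D v + 2 * (k - 3) + 2 * (k - 9) ≤ D.edgeFinset.card * k) ∧
      ∃ (D : SimpleGraph (Fin k)) (_ : DecidableRel D.Adj), K4mFree D ∧ D.edgeFinset.card + 2 = 4 * (k - 4) ∧
        (¬ ∃ A : Finset (Fin k), A.card = 4 ∧ BipSub D A) ∧
        ∑ v, deg D v * deg D v + 2 * (k - 3) + 2 * (k - 9) = D.edgeFinset.card * k := by
  have hcard : Fintype.card (Fin k) = k := Fintype.card_fin k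
  refine ⟨?_, ?_⟩
  · intro D _ hK hm hnb
    rcases four_two_second_order D hK (by rw [hcard]; exact hk) (by rw [hcard]; exact hm) with h | h
    · exact absurd h hnb
    · rw [hcard] at h
      exact h
  · obtain ⟨n, rfl⟩ : ∃ n, k = n + 1 := ⟨k - 1, by omega⟩
    obtain ⟨hK, hE, hS, hnb⟩ := tFamilyGen_value n 4 0 (by norm_num) (by omega) (by omega)
    refine ⟨tFamilyGen n 4 0 (by omega), inferInstance, hK, ?_, ?_, ?_⟩
    · have e : 0 + 4 - 2 = 2 := by norm_num
      rw [e] at hE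
      exact hE
    · rintro ⟨A, -, hA⟩
      exact hnb A hA
    · have e1 : 0 + 4 - 2 = 2 := by norm_num
      have e2 : n + 1 - 1 - 2 = n + 1 - 3 := by omega
      have e3 : n - 2 * 4 = n + 1 - 9 := by omega
      rw [e1, e2, e3] at hS
      simpa using hS

/-- **THE SAME IN THE TABLE'S COORDINATES:** the maximum of `2 · cherries` over the non-`4`-bipartite `K₄⁻`-free
graphs on `Fin k` with `4 (k − 4) − 2` edges is `m (k − 2) − 2 (k − 3) − 2 (k − 9)`, `10 ≤ k`. -/
theorem four_two_nonbip_second_best_cherries (k : ℕ) (hk : 10 ≤ k) :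
    (∀ (D : SimpleGraph (Fin k)) [DecidableRel D.Adj], K4mFree D → D.edgeFinset.card + 2 = 4 * (k - 4) →
        (¬ ∃ A : Finset (Fin k), A.card = 4 ∧ BipSub D A) →
        2 * cherries D + 2 * (k - 3) + 2 * (k - 9) ≤ D.edgeFinset.card * (k - 2)) ∧
      ∃ (D : SimpleGraph (Fin k)) (_ : DecidableRel D.Adj), K4mFree D ∧ D.edgeFinset.card + 2 = 4 * (k - 4) ∧
        (¬ ∃ A : Finset (Fin k), A.card = 4 ∧ BipSub D A) ∧
        2 * cherries D + 2 * (k - 3) + 2 * (k - 9) = D.edgeFinset.card * (k - 2) := by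
  have hcard : Fintype.card (Fin k) = k := Fintype.card_fin k
  obtain ⟨h1, D, inst, hK, hE, hnb, hS⟩ := four_two_nonbip_second_best k hk
  refine ⟨?_, D, inst, hK, hE, hnb, ?_⟩
  · intro D _ hK hm hnb
    have h := h1 D hK hm hnb
    have := (sum_deg_sq_le_iff_cherries D (2 * (k - 3) + 2 * (k - 9)) (by rw [hcard]; omega)).mp
      (by rw [hcard]; rw [← add_assoc]; exact h)
    rw [hcard] at this
    rw [add_assoc]
    exact this
  · have := (sum_deg_sq_eq_iff_cherries D (2 * (k - 3) + 2 * (k - 9)) (by rw [hcard]; omega)).mp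
      (by rw [hcard]; rw [← add_assoc]; exact hS)
    rw [hcard] at this
    rw [add_assoc]
    exact this

end C047

end TriangleCap

end PercRepro
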